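import Mathlib.Analysis.Normed.Group.FunctionSeries
import Mathlib.Analysis.SpecificLimits.Basic
import Mathlib.Topology.Order.IntermediateValue
import Mathlib.Order.Hom.Set
import Literature.Probability.RandomPlanarGeometry.CurveSpace
import HarnessLib

/-!
# Simple curve classes are a Borel set (discharge of `Literature.Probability.RandomPlanarGeometry.CurveClass.measurableSet_simple`)

The named fact `Literature.Probability.RandomPlanarGeometry.CurveClass.measurableSet_simple` (file `CurveSpace`; Aizenman–Burchard,
Duke Math. J. **99** (1999), §2.1: laws of random curves are Borel probability measures on the
space of curves modulo reparametrisation, and "the curve is simple" is an event) asserts that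
`CurveClass.simple = mk '' {γ | γ injective}` is a measurable subset of the metric space
`CurveClass E` of curves modulo reparametrisation. This file PROVES it, for every metric space `E`
(the completeness and separability hypotheses of the named fact are not needed), through the
following description of the simple classes, which is the content of the file:

* a curve `γ` is **flat** (`Curve.IsFlat`) if `γ s = γ t`, `s ≤ t`, forces `γ` to be constant on
  `[s, t]`; the flat non-constant curves are exactly the curves of the form `γ₀ ∘ φ` with `γ₀`
  injective and `φ : [0,1] → [0,1]` a continuous monotone surjection, and these are exactly the
  curves at reparametrisation distance `0` from an injective curve
  (`Curve.exists_isSimple_of_isFlat`, the monotone–light factorisation of a flat curve: the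
  collapsing map `φ = Curve.collapse γ` is built as a normalised series `∑ 2⁻ᵏ min(1, R_k)` of the
  running oscillations `R_k(t) = sup {dist (γ dₖ) (γ u) : dₖ ≤ u ≤ t}` from a dense sequence of base
  points `dₖ`, whose level sets are precisely the maximal intervals of constancy of `γ`; and
  `Curve.dist_precomp_eq_zero`: `γ₀ ∘ φ` is at distance `0` from `γ₀`, approximating `φ` by the
  homeomorphisms `(1 - c) φ + c · id`);
* flatness of a representative is detected by the closed events
  `CurveClass.modulusClass ε δ = {c | dist (γ s) (γ t) < δ ⟹ dist (γ s) (γ u) ≤ ε for s ≤ u ≤ t}`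
  (an injectivity modulus; closed because the condition passes to uniform limits and is invariant
  under reparametrisation), an injective curve having such a modulus for every `ε` by compactness;
* hence `simple = {c | c.source ≠ c.target} ∩ ⋂ₙ ⋃ₘ modulusClass (1/(n+1)) (1/(m+1))`
  (`CurveClass.simple_eq_iInter`), an open set intersected with an `F_{σδ}`, which is Borel
  (`CurveClass.measurableSet_simple'`, `CurveClass.measurableSet_simple_holds`).

All of this is standard point-set topology (Whyburn, *Analytic Topology*, monotone–light
factorisation; Aizenman–Burchard 1999 §2.1 for the curve space); tagged [folklore].
-/

noncomputable section

open Set Filter Topology MeasureTheory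
open scoped unitInterval

namespace Literature.Probability.RandomPlanarGeometry

/-! ### Two elementary distance estimates in `[0, 1]` -/

/-- For `s ≤ u ≤ t` in `[0, 1]`, `dist s u ≤ dist s t`. [folklore] -/
theorem unitInterval.dist_left_le {s u t : I} (hsu : s ≤ u) (hut : u ≤ t) :
    dist s u ≤ dist s t := by
  have h1 : (s : ℝ) ≤ u := hsu
  have h2 : (u : ℝ) ≤ t := hut
  rw [Subtype.dist_eq, Subtype.dist_eq, Real.dist_eq, Real.dist_eq, abs_sub_comm,
    abs_of_nonneg (by linarith), abs_sub_comm, abs_of_nonneg (by linarith)]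
  linarith

/-- For `s ≤ u ≤ t` in `[0, 1]`, `dist u t ≤ dist s t`. [folklore] -/
theorem unitInterval.dist_right_le {s u t : I} (hsu : s ≤ u) (hut : u ≤ t) :
    dist u t ≤ dist s t := by
  have h1 : (s : ℝ) ≤ u := hsu
  have h2 : (u : ℝ) ≤ t := hut
  rw [Subtype.dist_eq, Subtype.dist_eq, Real.dist_eq, Real.dist_eq, abs_sub_comm,
    abs_of_nonneg (by linarith), abs_sub_comm, abs_of_nonneg (by linarith)]
  linarith

namespace Curve

/-! ### Flat curves -/

section Topological

variable {E : Type*} [TopologicalSpace E]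

/-- A curve is **flat** if it takes equal values at `s ≤ t` only when it is constant on `[s, t]`:
the curves `γ₀ ∘ φ`, `γ₀` injective, `φ` monotone, are flat, and conversely
(`exists_isSimple_of_isFlat`). [folklore] -/
def IsFlat (γ : Curve E) : Prop :=
  ∀ s u t : I, s ≤ u → u ≤ t → γ s = γ t → γ u = γ s

/-- An injective curve is flat. [folklore] -/
theorem IsSimple.isFlat {γ : Curve E} (h : γ.IsSimple) : γ.IsFlat := by
  intro s u t hsu hut hst
  have := h hst
  subst this
  rw [le_antisymm hsu hut]

/-- Precomposition of a curve with a continuous self-map of the parameter interval. [folklore] -/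
def precomp (γ : Curve E) (φ : C(I, I)) : Curve E :=
  ⟨γ.toContinuousMap.comp φ⟩

/-- Pointwise formula for `precomp`. [folklore] -/
@[simp] theorem precomp_apply (γ : Curve E) (φ : C(I, I)) (t : I) : γ.precomp φ t = γ (φ t) :=
  rfl

end Topological

/-! ### Precomposition with a monotone continuous surjection does not change the class -/

section PseudoMetric

variable {E : Type*} [PseudoMetricSpace E]

/-- **A monotone reparametrisation is a limit of homeomorphic ones**: if `φ : [0,1] → [0,1]` is
continuous and monotone with `φ 0 = 0`, `φ 1 = 1`, then `γ ∘ φ` is at reparametrisation distance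
`0` from `γ` — the increasing homeomorphisms `(1 - c) φ + c · id`, `c ↓ 0`, converge uniformly to
`φ`, and `γ` is uniformly continuous (Aizenman–Burchard 1999, §2.1: the pseudo-metric identifies
curves differing by monotone reparametrisation). [folklore] -/
theorem dist_precomp_eq_zero (γ : Curve E) (φ : C(I, I)) (hφ : Monotone φ) (h0 : φ 0 = 0)
    (h1 : φ 1 = 1) : dist (γ.precomp φ) γ = 0 := by
  refine le_antisymm (le_of_forall_pos_le_add fun ε hε ↦ ?_) dist_nonneg
  rw [zero_add]
  obtain ⟨η, hη, hγ⟩ := Metric.uniformContinuous_iff.1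
    (CompactSpace.uniformContinuous_of_continuous γ.continuous) ε hε
  -- the perturbed reparametrisation `ψ = (1 - c) φ + c id`
  set c : ℝ := min (1 / 2) (η / 2) with hc
  have hc0 : 0 < c := lt_min (by norm_num) (half_pos hη)
  have hc1 : c < 1 := (min_le_left _ _).trans_lt (by norm_num)
  have hcη : c < η := (min_le_right _ _).trans_lt (half_lt_self hη)
  have hmem : ∀ t : I, (1 - c) * (φ t : ℝ) + c * t ∈ I := fun t ↦ by
    constructor
    · nlinarith [unitInterval.nonneg (φ t), unitInterval.nonneg t]
    · nlinarith [unitInterval.le_one (φ t), unitInterval.le_one t]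
  let ψ : I → I := fun t ↦ ⟨(1 - c) * (φ t : ℝ) + c * t, hmem t⟩
  have hψc : Continuous ψ := by
    refine Continuous.subtype_mk ?_ _
    fun_prop
  have hψm : StrictMono ψ := fun s t hst ↦ by
    have h₁ : (φ s : ℝ) ≤ φ t := hφ hst.le
    have h₂ : (s : ℝ) < t := hst
    show (1 - c) * (φ s : ℝ) + c * s < (1 - c) * (φ t : ℝ) + c * t
    nlinarith
  have hψ0 : ψ 0 = 0 := Subtype.ext (by simp [ψ, h0])
  have hψ1 : ψ 1 = 1 := Subtype.ext (by simp [ψ, h1])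
  have hψs : Function.Surjective ψ := fun x ↦ by
    have hx : x ∈ Icc (ψ 0) (ψ 1) := by
      rw [hψ0, hψ1]
      exact ⟨unitInterval.nonneg x, unitInterval.le_one x⟩
    exact intermediate_value_univ 0 1 hψc hx
  let Ψ : I ≃o I := StrictMono.orderIsoOfSurjective ψ hψm hψs
  calc dist (γ.precomp φ) γ
      ≤ dist (γ.precomp φ).toContinuousMap (γ.reparam Ψ).toContinuousMap := reparamDist_le _ _ Ψ
    _ ≤ ε := by
      refine (ContinuousMap.dist_le hε.le).2 fun t ↦ ?_
      change dist (γ (φ t)) (γ (ψ t)) ≤ ε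
      refine (hγ ?_).le
      rw [Subtype.dist_eq, Real.dist_eq]
      have hφt := unitInterval.nonneg (φ t)
      have hφt' := unitInterval.le_one (φ t)
      have ht := unitInterval.nonneg t
      have ht' := unitInterval.le_one t
      calc |(φ t : ℝ) - ((1 - c) * φ t + c * t)| = c * |(φ t : ℝ) - t| := by
            rw [show (φ t : ℝ) - ((1 - c) * φ t + c * t) = c * (φ t - t) by ring, abs_mul,
              abs_of_pos hc0]
        _ ≤ c * 1 := by
            gcongr
            rw [abs_sub_le_iff]
            constructor <;> linarith
        _ < η := by linarith

/-! ### Running oscillation of a curve from a base point -/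

/-- The **running oscillation** of `γ` from the base point `a` up to time `t`:
`sup {dist (γ a) (γ u) : a ≤ u ≤ t}` (`0` for `t < a`). It is continuous and monotone in `t`,
constant on every interval where `γ` is constant, and detects the intervals to the right of `a` on
which `γ` moves. [folklore] -/
def runSup (γ : Curve E) (a t : I) : ℝ :=
  sSup ((fun u ↦ dist (γ a) (γ u)) '' Icc a t)

/-- The running oscillation is nonnegative. [folklore] -/
theorem runSup_nonneg (γ : Curve E) (a t : I) : 0 ≤ γ.runSup a t :=
  Real.sSup_nonneg (by rintro _ ⟨u, -, rfl⟩; exact dist_nonneg)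

/-- The oscillations over a parameter interval are bounded (continuity on a compact set). [folklore] -/
theorem bddAbove_image_Icc (γ : Curve E) (a t : I) :
    BddAbove ((fun u ↦ dist (γ a) (γ u)) '' Icc a t) :=
  isCompact_Icc.bddAbove_image (by
    have : Continuous fun u ↦ dist (γ a) (γ u) := by
      have hγ := γ.continuous
      fun_prop
    exact this.continuousOn)

/-- Each oscillation is bounded by the running oscillation. [folklore] -/
theorem le_runSup (γ : Curve E) {a u t : I} (hau : a ≤ u) (hut : u ≤ t) :
    dist (γ a) (γ u) ≤ γ.runSup a t :=
  le_csSup (γ.bddAbove_image_Icc a t) ⟨u, ⟨hau, hut⟩, rfl⟩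

/-- The running oscillation is bounded by any nonnegative bound of the oscillations. [folklore] -/
theorem runSup_le (γ : Curve E) {a t : I} {C : ℝ} (hC : 0 ≤ C)
    (h : ∀ u, a ≤ u → u ≤ t → dist (γ a) (γ u) ≤ C) : γ.runSup a t ≤ C :=
  Real.sSup_le (by rintro _ ⟨u, ⟨hau, hut⟩, rfl⟩; exact h u hau hut) hC

/-- The running oscillation is monotone in time. [folklore] -/
theorem runSup_mono (γ : Curve E) (a : I) : Monotone (γ.runSup a) := fun _ t hst ↦
  γ.runSup_le (γ.runSup_nonneg a t) fun _ hau hus ↦ γ.le_runSup hau (hus.trans hst)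

/-- Before the base point the running oscillation vanishes. [folklore] -/
theorem runSup_of_lt (γ : Curve E) {a t : I} (h : t < a) : γ.runSup a t = 0 := by
  rw [runSup, Icc_eq_empty (not_le.2 h), image_empty, Real.sSup_empty]

/-- The running oscillation is constant on every interval on which the curve is constant. [folklore] -/
theorem runSup_eq_of_const (γ : Curve E) (a : I) {s t : I} (hst : s ≤ t)
    (h : ∀ u, s ≤ u → u ≤ t → γ u = γ s) : γ.runSup a s = γ.runSup a t := by
  refine le_antisymm (γ.runSup_mono a hst) ?_
  refine γ.runSup_le (γ.runSup_nonneg a s) fun u hau hut ↦ ?_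
  rcases le_total u s with hus | hsu
  · exact γ.le_runSup hau hus
  · rw [h u hsu hut]
    rcases le_total a s with has | hsa
    · exact γ.le_runSup has le_rfl
    · rw [h a hsa (hau.trans hut), dist_self]
      exact γ.runSup_nonneg a s

/-- The running oscillation is continuous in time (its modulus of continuity is that of `γ`). [folklore] -/
theorem continuous_runSup (γ : Curve E) (a : I) : Continuous (γ.runSup a) := by
  rw [Metric.continuous_iff]
  intro t ε hε
  obtain ⟨η, hη, hγ⟩ := Metric.uniformContinuous_iff.1
    (CompactSpace.uniformContinuous_of_continuous γ.continuous) (ε / 2) (half_pos hε)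
  -- one-sided estimate
  have key : ∀ t₁ t₂ : I, t₁ ≤ t₂ → dist t₁ t₂ < η →
      γ.runSup a t₂ ≤ γ.runSup a t₁ + ε / 2 := by
    intro t₁ t₂ h12 hd
    refine γ.runSup_le (add_nonneg (γ.runSup_nonneg a t₁) (half_pos hε).le) fun u hau hut ↦ ?_
    rcases le_total u t₁ with hu1 | h1u
    · exact (γ.le_runSup hau hu1).trans (le_add_of_nonneg_right (half_pos hε).le)
    · rcases le_total a t₁ with ha1 | h1a
      · have hd' : dist t₁ u < η := (unitInterval.dist_left_le h1u hut).trans_lt hd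
        calc dist (γ a) (γ u) ≤ dist (γ a) (γ t₁) + dist (γ t₁) (γ u) := dist_triangle _ _ _
          _ ≤ γ.runSup a t₁ + ε / 2 := add_le_add (γ.le_runSup ha1 le_rfl) (hγ hd').le
      · have hd' : dist a u < η :=
          ((unitInterval.dist_left_le hau hut).trans (unitInterval.dist_right_le h1a (hau.trans hut))).trans_lt
            hd
        exact (hγ hd').le.trans (le_add_of_nonneg_left (γ.runSup_nonneg a t₁))
  refine ⟨η, hη, fun s hs ↦ ?_⟩
  rw [Real.dist_eq, abs_sub_lt_iff]
  rcases le_total s t with hst | hts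
  · have h₁ := γ.runSup_mono a hst
    have h₂ := key s t hst hs
    constructor <;> linarith
  · have h₁ := γ.runSup_mono a hts
    have h₂ := key t s hts (by rwa [dist_comm] at hs)
    constructor <;> linarith

/-! ### The collapsing function of a curve -/

/-- The un-normalised **collapsing function** of `γ`: `∑ₖ 2⁻ᵏ min (1, R_k t)`, `R_k` the running
oscillation from the `k`-th point of a fixed dense sequence in `[0, 1]`. Continuous, monotone, and
`collapseFun γ s = collapseFun γ t` (`s ≤ t`) iff `γ` is constant on `[s, t]`
(`collapseFun_eq_iff`). [folklore] -/
def collapseFun (γ : Curve E) (t : I) : ℝ :=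
  ∑' k, (1 / 2 : ℝ) ^ k * min 1 (γ.runSup (TopologicalSpace.denseSeq I k) t)

/-- The terms of the collapsing series are nonnegative. [folklore] -/
theorem collapseFun_term_nonneg (γ : Curve E) (k : ℕ) (t : I) :
    0 ≤ (1 / 2 : ℝ) ^ k * min 1 (γ.runSup (TopologicalSpace.denseSeq I k) t) :=
  mul_nonneg (by positivity) (le_min zero_le_one (γ.runSup_nonneg _ _))

/-- The `k`-th term of the collapsing series is at most `2⁻ᵏ`. [folklore] -/
theorem collapseFun_term_le (γ : Curve E) (k : ℕ) (t : I) :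
    (1 / 2 : ℝ) ^ k * min 1 (γ.runSup (TopologicalSpace.denseSeq I k) t) ≤ (1 / 2 : ℝ) ^ k :=
  mul_le_of_le_one_right (by positivity) (min_le_left _ _)

/-- The collapsing series converges (dominated by the geometric series). [folklore] -/
theorem summable_collapseFun_term (γ : Curve E) (t : I) :
    Summable fun k ↦ (1 / 2 : ℝ) ^ k * min 1 (γ.runSup (TopologicalSpace.denseSeq I k) t) :=
  Summable.of_nonneg_of_le (γ.collapseFun_term_nonneg · t) (γ.collapseFun_term_le · t)
    summable_geometric_two

/-- The collapsing function is continuous. [folklore] -/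
theorem continuous_collapseFun (γ : Curve E) : Continuous γ.collapseFun := by
  refine continuous_tsum (fun k ↦ ?_) summable_geometric_two fun k t ↦ ?_
  · exact continuous_const.mul (continuous_const.min (γ.continuous_runSup _))
  · rw [Real.norm_eq_abs, abs_of_nonneg (γ.collapseFun_term_nonneg k t)]
    exact γ.collapseFun_term_le k t

/-- The collapsing function is monotone. [folklore] -/
theorem monotone_collapseFun (γ : Curve E) : Monotone γ.collapseFun := fun s t hst ↦
  Summable.tsum_le_tsum (fun k ↦ mul_le_mul_of_nonneg_left
    (min_le_min_left 1 (γ.runSup_mono _ hst)) (by positivity))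
    (γ.summable_collapseFun_term s) (γ.summable_collapseFun_term t)

/-- The collapsing function is constant on every interval on which the curve is constant. [folklore] -/
theorem collapseFun_eq_of_const (γ : Curve E) {s t : I} (hst : s ≤ t)
    (h : ∀ u, s ≤ u → u ≤ t → γ u = γ s) : γ.collapseFun s = γ.collapseFun t :=
  tsum_congr fun k ↦ by rw [γ.runSup_eq_of_const _ hst h]

end PseudoMetric

section Metric

variable {E : Type*} [MetricSpace E]

/-- The collapsing function increases strictly across every interval on which the curve moves:
some point `dₖ` of the dense sequence lies just to the right of `s` with `γ dₖ ≠ γ u` for a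
`u ∈ (dₖ, t]`, so that `R_k s = 0 < R_k t`. [folklore] -/
theorem collapseFun_lt_of_not_const (γ : Curve E) {s t : I} (hst : s ≤ t)
    (h : ¬ ∀ u, s ≤ u → u ≤ t → γ u = γ s) : γ.collapseFun s < γ.collapseFun t := by
  push Not at h
  obtain ⟨u, hsu, hut, hu⟩ := h
  have hsu' : s < u := lt_of_le_of_ne hsu (by rintro rfl; exact hu rfl)
  -- an initial segment `[s, l)` on which `γ ≠ γ u`
  have hW : {x : I | γ x ≠ γ u} ∈ 𝓝 s :=
    (isOpen_ne_fun γ.continuous continuous_const).mem_nhds (Ne.symm hu)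
  obtain ⟨l, hsl, hl⟩ := exists_Ico_subset_of_mem_nhds hW ⟨u, hsu'⟩
  -- a point of the dense sequence in `(s, min l u)`
  have hlt : s < min l u := lt_min hsl hsu'
  obtain ⟨_, ⟨k, rfl⟩, hk⟩ := (TopologicalSpace.denseRange_denseSeq I).exists_between hlt
  set d := TopologicalSpace.denseSeq I k with hd
  have hsd : s < d := hk.1
  have hdl : d < l := hk.2.trans_le (min_le_left _ _)
  have hdu : d < u := hk.2.trans_le (min_le_right _ _)
  have hγd : γ d ≠ γ u := hl ⟨hsd.le, hdl⟩
  -- the `k`-th term vanishes at `s` and is positive at `t`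
  refine Summable.tsum_lt_tsum_of_nonneg (i := k) (γ.collapseFun_term_nonneg · s)
    (fun j ↦ mul_le_mul_of_nonneg_left (min_le_min_left 1 (γ.runSup_mono _ hst))
      (by positivity)) ?_ (γ.summable_collapseFun_term t)
  rw [← hd, γ.runSup_of_lt hsd, min_eq_right zero_le_one, mul_zero]
  refine mul_pos (by positivity) (lt_min zero_lt_one ?_)
  exact (dist_pos.2 hγd).trans_le (γ.le_runSup hdu.le hut)

/-- **Level sets of the collapsing function**: for `s ≤ t`, `collapseFun γ s = collapseFun γ t`
iff `γ` is constant on `[s, t]`. [folklore] -/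
theorem collapseFun_eq_iff (γ : Curve E) {s t : I} (hst : s ≤ t) :
    γ.collapseFun s = γ.collapseFun t ↔ ∀ u, s ≤ u → u ≤ t → γ u = γ s := by
  refine ⟨fun h ↦ ?_, γ.collapseFun_eq_of_const hst⟩
  by_contra hcon
  exact (γ.collapseFun_lt_of_not_const hst hcon).ne h

/-- Equal values of the collapsing function force equal values of the curve. [folklore] -/
theorem apply_eq_of_collapseFun_eq (γ : Curve E) {a b : I} (h : γ.collapseFun a = γ.collapseFun b) :
    γ a = γ b := by
  rcases le_total a b with hab | hba
  · exact ((γ.collapseFun_eq_iff hab).1 h b hab le_rfl).symm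
  · exact (γ.collapseFun_eq_iff hba).1 h.symm a hba le_rfl

/-- For a non-constant curve the collapsing function increases from `0` to `1`. [folklore] -/
theorem collapseFun_zero_lt_one (γ : Curve E) (h01 : γ 0 ≠ γ 1) :
    γ.collapseFun 0 < γ.collapseFun 1 :=
  γ.collapseFun_lt_of_not_const bot_le fun h ↦ h01 (h 1 bot_le le_rfl).symm

/-- The **collapsing map** `φ = collapse γ : [0,1] → [0,1]` of a non-constant curve: the
collapsing function normalised to `φ 0 = 0`, `φ 1 = 1`. It is a continuous monotone surjection
whose level sets are exactly the maximal intervals of constancy of `γ`. [folklore] -/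
def collapse (γ : Curve E) (h01 : γ 0 ≠ γ 1) : C(I, I) where
  toFun t := ⟨(γ.collapseFun t - γ.collapseFun 0) / (γ.collapseFun 1 - γ.collapseFun 0), by
    have hpos := sub_pos.2 (γ.collapseFun_zero_lt_one h01)
    constructor
    · exact div_nonneg (sub_nonneg.2 (γ.monotone_collapseFun bot_le)) hpos.le
    · rw [div_le_one hpos]
      exact sub_le_sub_right (γ.monotone_collapseFun le_top) _⟩
  continuous_toFun := by
    refine Continuous.subtype_mk ?_ _
    exact (γ.continuous_collapseFun.sub continuous_const).div_const _

/-- The value of the collapsing map, as a real number. [folklore] -/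
theorem collapse_apply_coe (γ : Curve E) (h01 : γ 0 ≠ γ 1) (t : I) :
    (γ.collapse h01 t : ℝ) =
      (γ.collapseFun t - γ.collapseFun 0) / (γ.collapseFun 1 - γ.collapseFun 0) :=
  rfl

/-- The collapsing map is monotone. [folklore] -/
theorem monotone_collapse (γ : Curve E) (h01 : γ 0 ≠ γ 1) : Monotone (γ.collapse h01) := by
  intro s t hst
  show (γ.collapse h01 s : ℝ) ≤ γ.collapse h01 t
  rw [collapse_apply_coe, collapse_apply_coe]
  exact div_le_div_of_nonneg_right (sub_le_sub_right (γ.monotone_collapseFun hst) _)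
    (sub_pos.2 (γ.collapseFun_zero_lt_one h01)).le

/-- The collapsing map fixes `0`. [folklore] -/
@[simp] theorem collapse_zero (γ : Curve E) (h01 : γ 0 ≠ γ 1) : γ.collapse h01 0 = 0 :=
  Subtype.ext (by rw [collapse_apply_coe, sub_self, zero_div]; rfl)

/-- The collapsing map fixes `1`. [folklore] -/
@[simp] theorem collapse_one (γ : Curve E) (h01 : γ 0 ≠ γ 1) : γ.collapse h01 1 = 1 :=
  Subtype.ext (by
    rw [collapse_apply_coe, div_self (sub_pos.2 (γ.collapseFun_zero_lt_one h01)).ne']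
    rfl)

/-- The collapsing map is surjective. [folklore] -/
theorem surjective_collapse (γ : Curve E) (h01 : γ 0 ≠ γ 1) :
    Function.Surjective (γ.collapse h01) := fun x ↦ by
  have hx : x ∈ Icc (γ.collapse h01 0) (γ.collapse h01 1) := by
    rw [collapse_zero, collapse_one]
    exact ⟨unitInterval.nonneg x, unitInterval.le_one x⟩
  exact intermediate_value_univ 0 1 (γ.collapse h01).continuous hx

/-- Level sets of the collapsing map: `collapse γ a = collapse γ b` iff
`collapseFun γ a = collapseFun γ b`. [folklore] -/
theorem collapse_eq_iff (γ : Curve E) (h01 : γ 0 ≠ γ 1) {a b : I} :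
    γ.collapse h01 a = γ.collapse h01 b ↔ γ.collapseFun a = γ.collapseFun b := by
  have hpos := sub_pos.2 (γ.collapseFun_zero_lt_one h01)
  rw [← Subtype.coe_inj, collapse_apply_coe, collapse_apply_coe, div_left_inj' hpos.ne',
    sub_left_inj]

/-- **Monotone–light factorisation of a flat curve.** A flat non-constant curve `γ` is `γ₀ ∘ φ`
with `γ₀` an INJECTIVE curve and `φ = collapse γ` the collapsing map (a continuous monotone
surjection of `[0, 1]`); in particular `γ` is at reparametrisation distance `0` from the simple
curve `γ₀` (Whyburn, *Analytic Topology*, Ch. VIII; here for arcs). Proof: `γ` is constant on the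
fibres of `φ`, so `γ₀ = γ ∘ σ` for any section `σ` of `φ` satisfies `γ₀ ∘ φ = γ`; `γ₀` is
continuous because `φ` is a closed quotient map (`γ₀⁻¹(C) = φ(γ⁻¹(C))` is compact), and injective
because `γ₀ x = γ₀ y` makes `γ` constant between `σ x` and `σ y` (flatness), which are then in the
same fibre. [folklore] -/
theorem exists_isSimple_of_isFlat {γ : Curve E} (hflat : γ.IsFlat) (h01 : γ 0 ≠ γ 1) :
    ∃ γ₀ : Curve E, γ₀.IsSimple ∧ γ₀.precomp (γ.collapse h01) = γ ∧ dist γ γ₀ = 0 := by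
  set φ := γ.collapse h01 with hφ
  have hsurj := γ.surjective_collapse h01
  set sec := Function.surjInv hsurj with hsec
  have hφσ : ∀ x, φ (sec x) = x := Function.surjInv_eq hsurj
  -- `γ` is constant on the fibres of `φ`
  have hfib : ∀ a b, φ a = φ b → γ a = γ b := fun a b hab ↦
    γ.apply_eq_of_collapseFun_eq ((γ.collapse_eq_iff h01).1 hab)
  -- the candidate `γ₀ = γ ∘ σ`
  set f : I → E := fun x ↦ γ (sec x) with hf
  have hfφ : ∀ t, f (φ t) = γ t := fun t ↦ hfib _ _ (hφσ (φ t))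
  have hpre : ∀ C : Set E, f ⁻¹' C = φ '' (γ ⁻¹' C) := by
    intro C
    ext x
    constructor
    · intro hx
      exact ⟨sec x, hx, hφσ x⟩
    · rintro ⟨y, hy, rfl⟩
      show γ (sec (φ y)) ∈ C
      rwa [hfib _ _ (hφσ (φ y))]
  have hfc : Continuous f := by
    rw [continuous_iff_isClosed]
    intro C hC
    rw [hpre]
    exact ((hC.preimage γ.continuous).isCompact.image φ.continuous).isClosed
  refine ⟨⟨⟨f, hfc⟩⟩, ?_, ?_, ?_⟩
  · -- injectivity
    intro x y hxy
    change γ (sec x) = γ (sec y) at hxy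
    rw [← hφσ x, ← hφσ y]
    rcases le_total (sec x) (sec y) with hle | hle
    · exact (γ.collapse_eq_iff h01).2 ((γ.collapseFun_eq_iff hle).2
        fun u hxu huy ↦ hflat _ _ _ hxu huy hxy)
    · exact ((γ.collapse_eq_iff h01).2 ((γ.collapseFun_eq_iff hle).2
        fun u hyu hux ↦ hflat _ _ _ hyu hux hxy.symm)).symm
  · ext t
    exact hfφ t
  · have h := dist_precomp_eq_zero ⟨⟨f, hfc⟩⟩ φ (γ.monotone_collapse h01)
      (γ.collapse_zero h01) (γ.collapse_one h01)
    have heq : (⟨⟨f, hfc⟩⟩ : Curve E).precomp φ = γ := by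
      ext t
      exact hfφ t
    rwa [heq] at h

end Metric

/-! ### Injectivity moduli -/

section PseudoMetric

variable {E : Type*} [PseudoMetricSpace E]

/-- The curves with **injectivity modulus** `(ε, δ)`: whenever `γ s` and `γ t` are `δ`-close
(`s ≤ t`), the whole arc `γ [s, t]` stays `ε`-close to `γ s`. [folklore] -/
def modulusSet (ε δ : ℝ) : Set (Curve E) :=
  {γ | ∀ s u t : I, s ≤ u → u ≤ t → dist (γ s) (γ t) < δ → dist (γ s) (γ u) ≤ ε}

/-- Injectivity moduli are monotone in `ε` and antitone in `δ`. [folklore] -/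
theorem modulusSet_mono {ε ε' δ δ' : ℝ} (hε : ε ≤ ε') (hδ : δ' ≤ δ) :
    (modulusSet ε δ : Set (Curve E)) ⊆ modulusSet ε' δ' :=
  fun _ h s u t hsu hut hd ↦ (h s u t hsu hut (hd.trans_le hδ)).trans hε

/-- Injectivity moduli are invariant under reparametrisation. [folklore] -/
theorem reparam_mem_modulusSet {ε δ : ℝ} {γ : Curve E} (h : γ ∈ modulusSet ε δ)
    (φ : I ≃o I) : γ.reparam φ ∈ modulusSet ε δ :=
  fun s u t hsu hut hd ↦ h (φ s) (φ u) (φ t) (φ.monotone hsu) (φ.monotone hut) hd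

/-- Injectivity moduli pass to limits: a curve approximable in the reparametrisation distance by
curves with modulus `(ε, δ)` has modulus `(ε, δ)`. [folklore] -/
theorem mem_modulusSet_of_forall_exists {ε δ : ℝ} {γ : Curve E}
    (h : ∀ η > 0, ∃ γ' ∈ (modulusSet ε δ : Set (Curve E)), dist γ γ' < η) :
    γ ∈ modulusSet ε δ := by
  intro s u t hsu hut hd
  refine le_of_forall_pos_le_add fun η' hη' ↦ ?_
  -- choose `η` with `dist (γ s) (γ t) + 2η < δ` and `2η ≤ η'`
  obtain ⟨η, hη, hηδ, hηη'⟩ : ∃ η > 0, dist (γ s) (γ t) + 2 * η < δ ∧ 2 * η ≤ η' :=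
    ⟨min ((δ - dist (γ s) (γ t)) / 4) (η' / 2),
      lt_min (by linarith) (by linarith),
      by linarith [min_le_left ((δ - dist (γ s) (γ t)) / 4) (η' / 2)],
      by linarith [min_le_right ((δ - dist (γ s) (γ t)) / 4) (η' / 2)]⟩
  obtain ⟨γ', hγ', hdist⟩ := h η hη
  obtain ⟨φ, hφ⟩ := exists_dist_reparam_lt hdist
  have hmem := reparam_mem_modulusSet hγ' φ
  set γ'' := γ'.reparam φ
  have hpt : ∀ x, dist (γ x) (γ'' x) < η := fun x ↦
    (ContinuousMap.dist_apply_le_dist (f := γ.toContinuousMap) (g := γ''.toContinuousMap) x).trans_lt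
      hφ
  have h1 : dist (γ'' s) (γ'' t) < δ :=
    calc dist (γ'' s) (γ'' t) ≤ dist (γ'' s) (γ s) + dist (γ s) (γ t) + dist (γ t) (γ'' t) :=
          dist_triangle4 _ _ _ _
      _ < η + dist (γ s) (γ t) + η := by
          gcongr
          · rw [dist_comm]; exact hpt s
          · exact hpt t
      _ < δ := by linarith
  have h2 := hmem s u t hsu hut h1
  calc dist (γ s) (γ u) ≤ dist (γ s) (γ'' s) + dist (γ'' s) (γ'' u) + dist (γ'' u) (γ u) :=
        dist_triangle4 _ _ _ _
    _ ≤ η + ε + η := by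
        gcongr
        · exact (hpt s).le
        · rw [dist_comm]; exact (hpt u).le
    _ ≤ ε + η' := by linarith

end PseudoMetric

section Metric

variable {E : Type*} [MetricSpace E]

/-- **An injective curve has an injectivity modulus for every `ε > 0`**: by compactness,
`dist (γ s) (γ t)` is bounded below by some `δ > 0` on `{|s - t| ≥ η}`, where `η` is a modulus of
uniform continuity of `γ` for `ε`. [folklore] -/
theorem IsSimple.exists_mem_modulusSet {γ : Curve E} (hγ : γ.IsSimple) {ε : ℝ} (hε : 0 < ε) :
    ∃ δ > 0, γ ∈ (modulusSet ε δ : Set (Curve E)) := by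
  obtain ⟨η, hη, hγc⟩ := Metric.uniformContinuous_iff.1
    (CompactSpace.uniformContinuous_of_continuous γ.continuous) ε hε
  -- the compact set of pairs at parameter distance `≥ η`
  set K : Set (I × I) := {p | η ≤ dist p.1 p.2} with hK
  have hKc : IsCompact K :=
    (isClosed_le continuous_const continuous_dist).isCompact
  have hcont : ContinuousOn (fun p : I × I ↦ dist (γ p.1) (γ p.2)) K := by
    have hγ' := γ.continuous
    exact Continuous.continuousOn (by fun_prop)
  have hposK : ∀ p ∈ K, (0 : ℝ) < dist (γ p.1) (γ p.2) := by
    intro p hp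
    refine dist_pos.2 fun h ↦ ?_
    have := hγ h
    have hp' : η ≤ dist p.1 p.2 := hp
    rw [this, dist_self] at hp'
    exact absurd hp' (not_le.2 hη)
  obtain ⟨δ, hδ, hδK⟩ := hKc.exists_forall_le' hcont hposK
  refine ⟨δ, hδ, fun s u t hsu hut hd ↦ ?_⟩
  have hst : dist s t < η := by
    by_contra hcon
    exact absurd (hδK (s, t) (not_lt.1 hcon)) (not_le.2 hd)
  exact (hγc ((unitInterval.dist_left_le hsu hut).trans_lt hst)).le

/-- A curve with injectivity moduli for all `ε > 0` is flat. [folklore] -/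
theorem isFlat_of_forall_mem_modulusSet {γ : Curve E}
    (h : ∀ ε > 0, ∃ δ > 0, γ ∈ (modulusSet ε δ : Set (Curve E))) : γ.IsFlat := by
  intro s u t hsu hut hst
  refine (dist_le_zero.1 (le_of_forall_pos_le_add fun ε hε ↦ ?_)).symm
  obtain ⟨δ, hδ, hγ⟩ := h ε hε
  rw [zero_add]
  exact hγ s u t hsu hut (by rwa [hst, dist_self])

end Metric

end Curve

namespace CurveClass

variable {E : Type*} [MetricSpace E]

/-- The event "some representative has injectivity modulus `(ε, δ)`". [folklore] -/
def modulusClass (ε δ : ℝ) : Set (CurveClass E) :=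
  {c | ∃ γ, mk γ = c ∧ γ ∈ (Curve.modulusSet ε δ : Set (Curve E))}

/-- If some representative has modulus `(ε, δ)` then every representative does (moduli pass to
limits and are reparametrisation invariant). [folklore] -/
theorem mem_modulusSet_of_mk_mem {ε δ : ℝ} {γ : Curve E} (h : mk γ ∈ modulusClass ε δ) :
    γ ∈ (Curve.modulusSet ε δ : Set (Curve E)) := by
  obtain ⟨γ', hγ', hmem⟩ := h
  refine Curve.mem_modulusSet_of_forall_exists fun η hη ↦ ⟨γ', hmem, ?_⟩
  rw [← dist_mk_mk, hγ', dist_self]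
  exact hη

/-- Membership of a class in `modulusClass` is membership of any representative in
`modulusSet`. [folklore] -/
theorem mk_mem_modulusClass_iff {ε δ : ℝ} {γ : Curve E} :
    mk γ ∈ modulusClass ε δ ↔ γ ∈ (Curve.modulusSet ε δ : Set (Curve E)) :=
  ⟨mem_modulusSet_of_mk_mem, fun h ↦ ⟨γ, rfl, h⟩⟩

/-- The modulus events are monotone in `ε` and antitone in `δ`. [folklore] -/
theorem modulusClass_mono {ε ε' δ δ' : ℝ} (hε : ε ≤ ε') (hδ : δ' ≤ δ) :
    (modulusClass ε δ : Set (CurveClass E)) ⊆ modulusClass ε' δ' := by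
  rintro _ ⟨γ, rfl, h⟩
  exact ⟨γ, rfl, Curve.modulusSet_mono hε hδ h⟩

/-- **The modulus events are closed** in the space of curve classes. [folklore] -/
theorem isClosed_modulusClass (ε δ : ℝ) : IsClosed (modulusClass ε δ : Set (CurveClass E)) := by
  refine isClosed_of_closure_subset fun c hc ↦ ?_
  obtain ⟨γ, rfl⟩ := surjective_mk c
  rw [Metric.mem_closure_iff] at hc
  refine ⟨γ, rfl, Curve.mem_modulusSet_of_forall_exists fun η hη ↦ ?_⟩
  obtain ⟨c', hc', hd⟩ := hc η hη
  obtain ⟨γ', rfl⟩ := surjective_mk c'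
  exact ⟨γ', mem_modulusSet_of_mk_mem hc', by rwa [dist_mk_mk] at hd⟩

/-- The modulus events are Borel. [folklore] -/
theorem measurableSet_modulusClass (ε δ : ℝ) :
    MeasurableSet (modulusClass ε δ : Set (CurveClass E)) :=
  (isClosed_modulusClass ε δ).measurableSet

/-- The event "the endpoints differ" is open. [folklore] -/
theorem isOpen_source_ne_target : IsOpen {c : CurveClass E | c.source ≠ c.target} :=
  isOpen_ne_fun continuous_source continuous_target

/-- **Description of the simple classes**: a class is simple iff its endpoints differ and it has
an injectivity modulus for every `ε = 1/(n+1)`. (`⊆`: an injective curve has distinct endpoints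
and all moduli; `⊇`: a representative with all moduli is flat, and a flat curve with distinct
endpoints is at distance `0` from an injective one, `Curve.exists_isSimple_of_isFlat`.) [folklore] -/
theorem simple_eq_iInter :
    (simple : Set (CurveClass E)) = {c | c.source ≠ c.target} ∩
      ⋂ n : ℕ, ⋃ m : ℕ, modulusClass (1 / (n + 1 : ℝ)) (1 / (m + 1 : ℝ)) := by
  ext c
  simp only [mem_inter_iff, mem_setOf_eq, mem_iInter, mem_iUnion]
  constructor
  · rintro ⟨γ, hγ, rfl⟩
    refine ⟨fun h ↦ ?_, fun n ↦ ?_⟩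
    · have h' : γ 0 = γ 1 := h
      exact absurd (hγ h') zero_ne_one
    · obtain ⟨δ, hδ, hmem⟩ := Curve.IsSimple.exists_mem_modulusSet hγ
        (ε := 1 / (n + 1 : ℝ)) (by positivity)
      obtain ⟨m, hm⟩ := exists_nat_one_div_lt hδ
      exact ⟨m, γ, rfl, Curve.modulusSet_mono le_rfl hm.le hmem⟩
  · rintro ⟨hne, h⟩
    obtain ⟨γ, rfl⟩ := surjective_mk c
    have h01 : γ 0 ≠ γ 1 := hne
    have hflat : γ.IsFlat := by
      refine Curve.isFlat_of_forall_mem_modulusSet fun ε hε ↦ ?_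
      obtain ⟨n, hn⟩ := exists_nat_one_div_lt hε
      obtain ⟨m, hm⟩ := h n
      exact ⟨1 / (m + 1 : ℝ), by positivity,
        Curve.modulusSet_mono hn.le le_rfl (mem_modulusSet_of_mk_mem hm)⟩
    obtain ⟨γ₀, hγ₀, -, hd⟩ := Curve.exists_isSimple_of_isFlat hflat h01
    refine ⟨γ₀, hγ₀, ?_⟩
    rw [mk_eq_mk_iff_dist_eq_zero, dist_comm]
    exact hd

/-- **Simplicity is a Borel event in curve space**, for every metric space `E`. [folklore] -/
theorem measurableSet_simple' : MeasurableSet (simple : Set (CurveClass E)) := by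
  rw [simple_eq_iInter]
  exact isOpen_source_ne_target.measurableSet.inter (MeasurableSet.iInter fun n ↦
    MeasurableSet.iUnion fun m ↦ measurableSet_modulusClass _ _)

/-- Discharge of the named fact `CurveClass.measurableSet_simple` (Aizenman–Burchard, Duke
Math. J. **99** (1999), §2.1: simplicity is an event of the Borel curve space): proved above for
every metric space, the completeness and separability hypotheses being unnecessary.
[cite: AizenmanBurchard1999, §2.1] -/
theorem measurableSet_simple_holds : measurableSet_simple (E := E) := by
  intro _ _
  exact measurableSet_simple'

end CurveClass

end Literature.Probability.RandomPlanarGeometry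

end
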